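import Summits.Ventures.PercRepro.RankLevelSetRuleQCellTwo

/-!
# PercRepro — THE ROW IDENTITIES BEHIND THE CELL `(q+3, q)`: weighted partial sums of ONE binomial row
(p4, gen 21; paper proofs/P4-CELL-THREE.md §1–§3)

Everything about the cell `(q+3, q)` lives on the single binomial row `N = q + m + 1 = 2m + u + 1` (`u = q − m`):
with `Q = Σ_{i ≤ m} C(N, i)`, `D = Σ_{i ≤ m} (m − i)·C(N, i)` and `V = Σ_{i ≤ m} (m + 1 − i)²·C(N, i)`,
* the two slice sums of the cell are POSITIVE combinations: `S₁ = Σ_a C(m, a)/C(q+1+a, a+1) = (D + Q)/((q+1)·C(N, m))`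
  (`sliceOne_eq_row`) and `S₂ = Σ_a C(m, a)/C(q+2+a, a+2) = 2V/((q+1)(q+m+2)·C(N, m))` (`sliceTwo_eq_row`);
* two telescoping identities tie them to `C(N, m)` (`(N − i)·C(N, i) = (i+1)·C(N, i+1)`, `sum_telescope_choose`):
  `(u+1)·Q + 2·D = (q+1)·C(N, m)` (`row_id_one`) and `2(u+1)·V + (u² − u + 2m + 2)·D = (m+2)(q+1)·C(N, m)` (`row_id_two`);
* the geometric tail of RankLevelSetRuleQCellTwo on the row `N` bounds `D` from above:
  `D·((u+1)(u+2) + 2m) ≤ m(q+1)·C(N, m)` (`row_D_le`).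
The cell `(q+3, q)` is then one polynomial inequality with non-negative coefficients (RankLevelSetRuleQCellThree).
Axioms: standard.
-/

namespace PercRepro

open Finset

/-! ### §1 Telescoping on a binomial row -/

/-- `(N − i)·C(N, i) = (i + 1)·C(N, i + 1)` in `ℚ` for `i ≤ N` (cast of `Nat.choose_succ_right_eq`). -/
lemma cast_choose_succ_right (N i : ℕ) (hi : i ≤ N) :
    ((N : ℚ) - i) * (N.choose i : ℚ) = (i + 1) * (N.choose (i + 1) : ℚ) := by
  have h := Nat.choose_succ_right_eq N i
  have h' : ((N.choose (i + 1) * (i + 1) : ℕ) : ℚ) = ((N.choose i * (N - i) : ℕ) : ℚ) := by rw [h]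
  push_cast [Nat.cast_sub hi] at h'
  linarith [h']

/-- Telescoping: `Σ_{i < M} (F(i+1)·(N − i) − F(i)·i)·C(N, i) = F(M)·M·C(N, M)` for `M ≤ N`. -/
lemma sum_telescope_choose (N M : ℕ) (hM : M ≤ N) (F : ℕ → ℚ) :
    ∑ i ∈ range M, (F (i + 1) * ((N : ℚ) - i) - F i * i) * (N.choose i : ℚ)
      = F M * M * (N.choose M : ℚ) := by
  have h := Finset.sum_range_sub (fun i => F i * i * (N.choose i : ℚ)) M
  simp only [Nat.cast_zero, mul_zero, zero_mul, sub_zero] at h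
  rw [← h]
  refine Finset.sum_congr rfl (fun i hi => ?_)
  rw [Finset.mem_range] at hi
  have hc := cast_choose_succ_right N i (by omega)
  push_cast
  linear_combination F (i + 1) * hc

/-! ### §2 The two identities on the row `N = 2m + u + 1` -/

/-- `(u+1)·Σ_{i ≤ m} C(N, i) + 2·Σ_{i ≤ m} (m − i)·C(N, i) = (m + u + 1)·C(N, m)` on the row `N = 2m + u + 1`. -/
lemma row_id_one (m u : ℕ) :
    ((u : ℚ) + 1) * ∑ i ∈ range (m + 1), ((2 * m + u + 1).choose i : ℚ)
      + 2 * ∑ i ∈ range (m + 1), ((m : ℚ) - i) * ((2 * m + u + 1).choose i : ℚ)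
      = ((m : ℚ) + u + 1) * ((2 * m + u + 1).choose m : ℚ) := by
  have h := sum_telescope_choose (2 * m + u + 1) (m + 1) (by omega) (fun _ => 1)
  have hc := cast_choose_succ_right (2 * m + u + 1) m (by omega)
  rw [Finset.mul_sum, Finset.mul_sum, ← Finset.sum_add_distrib]
  have hsum : ∑ i ∈ range (m + 1), (((u : ℚ) + 1) * ((2 * m + u + 1).choose i : ℚ)
      + 2 * (((m : ℚ) - i) * ((2 * m + u + 1).choose i : ℚ)))
      = ∑ i ∈ range (m + 1), ((1 : ℚ) * (((2 * m + u + 1 : ℕ) : ℚ) - i) - 1 * i) * ((2 * m + u + 1).choose i : ℚ) := by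
    refine Finset.sum_congr rfl (fun i _ => ?_)
    push_cast; ring
  rw [hsum, h]
  push_cast at hc ⊢
  linear_combination (-1 : ℚ) * hc

/-- `2(u+1)·Σ_{i ≤ m} (m+1−i)²·C(N, i) + (u² − u + 2m + 2)·Σ_{i ≤ m} (m − i)·C(N, i) = (m+2)(m+u+1)·C(N, m)`
on the row `N = 2m + u + 1` (telescoping with `F(i) = (u+2)(m+1) + 1 − (u+1)·i`). -/
lemma row_id_two (m u : ℕ) :
    2 * ((u : ℚ) + 1) * ∑ i ∈ range (m + 1), ((m : ℚ) + 1 - i) ^ 2 * ((2 * m + u + 1).choose i : ℚ)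
      + ((u : ℚ) ^ 2 - u + 2 * m + 2) * ∑ i ∈ range (m + 1), ((m : ℚ) - i) * ((2 * m + u + 1).choose i : ℚ)
      = ((m : ℚ) + 2) * ((m : ℚ) + u + 1) * ((2 * m + u + 1).choose m : ℚ) := by
  have h := sum_telescope_choose (2 * m + u + 1) (m + 1) (by omega)
    (fun i => ((u : ℚ) + 2) * (m + 1) + 1 - (u + 1) * i)
  have hc := cast_choose_succ_right (2 * m + u + 1) m (by omega)
  rw [Finset.mul_sum, Finset.mul_sum, ← Finset.sum_add_distrib]
  have hsum : ∑ i ∈ range (m + 1), (2 * ((u : ℚ) + 1) * (((m : ℚ) + 1 - i) ^ 2 * ((2 * m + u + 1).choose i : ℚ))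
      + ((u : ℚ) ^ 2 - u + 2 * m + 2) * (((m : ℚ) - i) * ((2 * m + u + 1).choose i : ℚ)))
      = ∑ i ∈ range (m + 1), ((((u : ℚ) + 2) * (m + 1) + 1 - (u + 1) * ((i + 1 : ℕ) : ℚ)) * (((2 * m + u + 1 : ℕ) : ℚ) - i)
          - (((u : ℚ) + 2) * (m + 1) + 1 - (u + 1) * i) * i) * ((2 * m + u + 1).choose i : ℚ) := by
    refine Finset.sum_congr rfl (fun i _ => ?_)
    push_cast; ring
  rw [hsum, h]
  push_cast at hc ⊢
  linear_combination (-((m : ℚ) + 2)) * hc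

/-! ### §3 The geometric bound on `D` (from `geom_tail` on the row `N`) -/

/-- `(u+2)·Σ_{i<M} (M−i)·C(N, i) ≤ m·Σ_{j<M} C(N, j+1)` for `M ≤ m` on the row `N = 2m+u+1`. -/
lemma weighted_geom (m u : ℕ) : ∀ M ≤ m,
    (u + 2) * ∑ i ∈ range M, (M - i) * (2 * m + u + 1).choose i
      ≤ m * ∑ j ∈ range M, (2 * m + u + 1).choose (j + 1) := by
  intro M
  induction M with
  | zero => intro _; simp
  | succ M ih =>
    intro hM
    have ih' := ih (by omega)
    have hg := geom_tail (m + u + 1) m (by omega) (M + 1) (by omega)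
    rw [show m + u + 1 - m + 1 = u + 2 by omega, show m + u + 1 + m = 2 * m + u + 1 by ring] at hg
    have hsplit : ∑ i ∈ range (M + 1), (M + 1 - i) * (2 * m + u + 1).choose i
        = ∑ i ∈ range M, (M - i) * (2 * m + u + 1).choose i
          + ∑ i ∈ range (M + 1), (2 * m + u + 1).choose i := by
      rw [Finset.sum_range_succ, Finset.sum_range_succ (fun i => (2 * m + u + 1).choose i), ← add_assoc,
        ← Finset.sum_add_distrib, Nat.add_sub_cancel_left, one_mul]
      congr 1
      refine Finset.sum_congr rfl (fun i hi => ?_)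
      rw [Finset.mem_range] at hi
      rw [show M + 1 - i = (M - i) + 1 by omega, add_mul, one_mul]
    rw [hsplit, mul_add, Finset.sum_range_succ (fun j => (2 * m + u + 1).choose (j + 1)), mul_add]
    exact Nat.add_le_add ih' hg

/-- The `ℕ`-sum `Σ_{i<m} (m−i)·C(N, i)` as the `ℚ`-sum `Σ_{i<m+1} (m−i)·C(N, i)`. -/
lemma cast_D_eq (m N : ℕ) :
    ((∑ i ∈ range m, (m - i) * N.choose i : ℕ) : ℚ)
      = ∑ i ∈ range (m + 1), ((m : ℚ) - i) * (N.choose i : ℚ) := by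
  rw [Finset.sum_range_succ, sub_self, zero_mul, add_zero]
  push_cast
  refine Finset.sum_congr rfl (fun i hi => ?_)
  rw [Finset.mem_range] at hi
  rw [Nat.cast_sub hi.le]

/-- **The geometric bound on `D`**: `D·((u+1)(u+2) + 2m) ≤ m(m+u+1)·C(N, m)` on the row `N = 2m+u+1`. -/
lemma row_D_le (m u : ℕ) :
    (∑ i ∈ range (m + 1), ((m : ℚ) - i) * ((2 * m + u + 1).choose i : ℚ)) * (((u : ℚ) + 1) * (u + 2) + 2 * m)
      ≤ m * ((m : ℚ) + u + 1) * ((2 * m + u + 1).choose m : ℚ) := by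
  have h1 := weighted_geom m u m le_rfl
  have h2 : ∑ j ∈ range m, (2 * m + u + 1).choose (j + 1)
      ≤ ∑ i ∈ range (m + 1), (2 * m + u + 1).choose i := by
    rw [Finset.sum_range_succ']; exact Nat.le_add_right _ _
  have h3 : (u + 2) * ∑ i ∈ range m, (m - i) * (2 * m + u + 1).choose i
      ≤ m * ∑ i ∈ range (m + 1), (2 * m + u + 1).choose i :=
    h1.trans (Nat.mul_le_mul_left _ h2)
  have h3' : ((u : ℚ) + 2) * ∑ i ∈ range (m + 1), ((m : ℚ) - i) * ((2 * m + u + 1).choose i : ℚ)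
      ≤ m * ∑ i ∈ range (m + 1), ((2 * m + u + 1).choose i : ℚ) := by
    have := (Nat.cast_le (α := ℚ)).2 h3
    rw [Nat.cast_mul, Nat.cast_mul, cast_D_eq] at this
    push_cast at this
    exact this
  have hid := row_id_one m u
  have hu : (0 : ℚ) ≤ u + 1 := by positivity
  have hmul := mul_le_mul_of_nonneg_left h3' hu
  have hid' : (m : ℚ) * (((u : ℚ) + 1) * ∑ i ∈ range (m + 1), ((2 * m + u + 1).choose i : ℚ)
      + 2 * ∑ i ∈ range (m + 1), ((m : ℚ) - i) * ((2 * m + u + 1).choose i : ℚ))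
      = m * (((m : ℚ) + u + 1) * ((2 * m + u + 1).choose m : ℚ)) := by rw [hid]
  linarith [hmul, hid']

/-! ### §4 The two slice sums of the cell `(q+3, q)` in positive form -/

/-- **`S₁` on the row `N = q+1+m`**: `Σ_{a ≤ m} C(m, a)/C(q+1+a, a+1) = (Σ_{i ≤ m} (m+1−i)·C(N, i)) / ((q+1)·C(N, m))`. -/
lemma sliceOne_eq_row (q m : ℕ) :
    ∑ a ∈ range (m + 1), (m.choose a : ℚ) / ((q + 1 + a).choose (a + 1) : ℚ)
      = (∑ i ∈ range (m + 1), ((m : ℚ) + 1 - i) * ((q + 1 + m).choose i : ℚ))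
          / ((q + 1) * ((q + 1 + m).choose m : ℚ)) := by
  have hrefl := Finset.sum_range_reflect
    (fun i => ((m : ℚ) + 1 - i) * ((q + 1 + m).choose i : ℚ)) (m + 1)
  rw [← hrefl, Finset.sum_div]
  refine Finset.sum_congr rfl (fun a ha => ?_)
  rw [Finset.mem_range] at ha
  rw [show m + 1 - 1 - a = m - a by omega, Nat.cast_sub (by omega : a ≤ m)]
  have h1 : ((q + 1 + a).choose (a + 1) : ℚ) * (a + 1) = ((q + 1 + a).choose a : ℚ) * (q + 1) := by
    have h := Nat.choose_succ_right_eq (q + 1 + a) a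
    rw [show q + 1 + a - a = q + 1 by omega] at h
    exact_mod_cast h
  have h2 : (m.choose a : ℚ) * ((q + 1 + m).choose m : ℚ)
      = ((q + 1 + m).choose (m - a) : ℚ) * ((q + 1 + a).choose a : ℚ) := by
    exact_mod_cast choose_mul_choose_symm_eq (q + 1) m a (by omega)
  have hA : (0 : ℚ) < (q + 1 + a).choose (a + 1) := by exact_mod_cast Nat.choose_pos (by omega)
  have hC : (0 : ℚ) < (q + 1 + m).choose m := by exact_mod_cast Nat.choose_pos (by omega)
  rw [div_eq_div_iff hA.ne' (by positivity)]
  rw [show ((m : ℚ) + 1 - ((m : ℚ) - a)) = a + 1 by ring]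
  linear_combination (-(((q + 1 + m).choose (m - a) : ℚ))) * h1 + ((q : ℚ) + 1) * h2

/-- Pascal with the weights of `S₂`: `Σ_{i ≤ m} (m+1−i)(m+2−i)·C(N+1, i) = 2·Σ_{i ≤ m} (m+1−i)²·C(N, i)`. -/
lemma pascal_weighted (N m : ℕ) :
    ∑ i ∈ range (m + 1), ((m : ℚ) + 1 - i) * ((m : ℚ) + 2 - i) * ((N + 1).choose i : ℚ)
      = 2 * ∑ i ∈ range (m + 1), ((m : ℚ) + 1 - i) ^ 2 * (N.choose i : ℚ) := by
  have hL : ∑ i ∈ range (m + 1), ((m : ℚ) + 1 - i) * ((m : ℚ) + 2 - i) * ((N + 1).choose i : ℚ)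
      = ((m : ℚ) + 1) * (m + 2)
        + ∑ i ∈ range m, ((m : ℚ) - i) * ((m : ℚ) + 1 - i) * ((N.choose i : ℚ) + (N.choose (i + 1) : ℚ)) := by
    rw [Finset.sum_range_succ']
    simp only [Nat.cast_zero, sub_zero, Nat.choose_zero_right, Nat.cast_one, mul_one]
    rw [add_comm]
    congr 1
    refine Finset.sum_congr rfl (fun i _ => ?_)
    rw [Nat.choose_succ_succ']
    push_cast; ring
  have hR : 2 * ∑ i ∈ range (m + 1), ((m : ℚ) + 1 - i) ^ 2 * (N.choose i : ℚ)
      = ∑ i ∈ range (m + 1), ((m : ℚ) + 1 - i) * ((m : ℚ) + 2 - i) * (N.choose i : ℚ)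
        + ∑ i ∈ range (m + 1), ((m : ℚ) - i) * ((m : ℚ) + 1 - i) * (N.choose i : ℚ) := by
    rw [Finset.mul_sum, ← Finset.sum_add_distrib]
    refine Finset.sum_congr rfl (fun i _ => ?_)
    ring
  have hR1 : ∑ i ∈ range (m + 1), ((m : ℚ) + 1 - i) * ((m : ℚ) + 2 - i) * (N.choose i : ℚ)
      = ((m : ℚ) + 1) * (m + 2) + ∑ i ∈ range m, ((m : ℚ) - i) * ((m : ℚ) + 1 - i) * (N.choose (i + 1) : ℚ) := by
    rw [Finset.sum_range_succ']
    simp only [Nat.cast_zero, sub_zero, Nat.choose_zero_right, Nat.cast_one, mul_one]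
    rw [add_comm]
    congr 1
    refine Finset.sum_congr rfl (fun i _ => ?_)
    push_cast; ring
  have hR2 : ∑ i ∈ range (m + 1), ((m : ℚ) - i) * ((m : ℚ) + 1 - i) * (N.choose i : ℚ)
      = ∑ i ∈ range m, ((m : ℚ) - i) * ((m : ℚ) + 1 - i) * (N.choose i : ℚ) := by
    rw [Finset.sum_range_succ, sub_self, zero_mul, zero_mul, add_zero]
  rw [hL, hR, hR1, hR2, add_assoc, ← Finset.sum_add_distrib]
  congr 1
  refine Finset.sum_congr rfl (fun i _ => ?_)
  ring

/-- **`S₂` on the row `N = q+1+m`**: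
`Σ_{a ≤ m} C(m, a)/C(q+2+a, a+2) = 2·(Σ_{i ≤ m} (m+1−i)²·C(N, i)) / ((q+1)(q+m+2)·C(N, m))`. -/
lemma sliceTwo_eq_row (q m : ℕ) :
    ∑ a ∈ range (m + 1), (m.choose a : ℚ) / ((q + 2 + a).choose (a + 2) : ℚ)
      = 2 * (∑ i ∈ range (m + 1), ((m : ℚ) + 1 - i) ^ 2 * ((q + 1 + m).choose i : ℚ))
          / ((q + 1) * ((q : ℚ) + m + 2) * ((q + 1 + m).choose m : ℚ)) := by
  -- first on the row `q + 2 + m`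
  have hrow : ∑ a ∈ range (m + 1), (m.choose a : ℚ) / ((q + 2 + a).choose (a + 2) : ℚ)
      = (∑ i ∈ range (m + 1), ((m : ℚ) + 1 - i) * ((m : ℚ) + 2 - i) * ((q + 2 + m).choose i : ℚ))
          / ((q + 1) * (q + 2) * ((q + 2 + m).choose m : ℚ)) := by
    have hrefl := Finset.sum_range_reflect
      (fun i => ((m : ℚ) + 1 - i) * ((m : ℚ) + 2 - i) * ((q + 2 + m).choose i : ℚ)) (m + 1)
    rw [← hrefl, Finset.sum_div]
    refine Finset.sum_congr rfl (fun a ha => ?_)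
    rw [Finset.mem_range] at ha
    rw [show m + 1 - 1 - a = m - a by omega, Nat.cast_sub (by omega : a ≤ m)]
    have h1 : ((q + 2 + a).choose (a + 2) : ℚ) * (a + 2) = ((q + 2 + a).choose (a + 1) : ℚ) * (q + 1) := by
      have h := Nat.choose_succ_right_eq (q + 2 + a) (a + 1)
      rw [show q + 2 + a - (a + 1) = q + 1 by omega] at h
      exact_mod_cast h
    have h1' : ((q + 2 + a).choose (a + 1) : ℚ) * (a + 1) = ((q + 2 + a).choose a : ℚ) * (q + 2) := by
      have h := Nat.choose_succ_right_eq (q + 2 + a) a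
      rw [show q + 2 + a - a = q + 2 by omega] at h
      exact_mod_cast h
    have h2 : (m.choose a : ℚ) * ((q + 2 + m).choose m : ℚ)
        = ((q + 2 + m).choose (m - a) : ℚ) * ((q + 2 + a).choose a : ℚ) := by
      exact_mod_cast choose_mul_choose_symm_eq (q + 2) m a (by omega)
    have hA : (0 : ℚ) < (q + 2 + a).choose (a + 2) := by exact_mod_cast Nat.choose_pos (by omega)
    have hC : (0 : ℚ) < (q + 2 + m).choose m := by exact_mod_cast Nat.choose_pos (by omega)
    rw [div_eq_div_iff hA.ne' (by positivity)]
    rw [show ((m : ℚ) + 1 - ((m : ℚ) - a)) = a + 1 by ring,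
      show ((m : ℚ) + 2 - ((m : ℚ) - a)) = a + 2 by ring]
    linear_combination (-(((q + 2 + m).choose (m - a) : ℚ)) * ((a : ℚ) + 1)) * h1
      - (((q + 2 + m).choose (m - a) : ℚ) * ((q : ℚ) + 1)) * h1' + ((q : ℚ) + 1) * ((q : ℚ) + 2) * h2
  rw [hrow, show q + 2 + m = q + 1 + m + 1 by ring, pascal_weighted]
  have hCC : ((q + 1 + m + 1).choose m : ℚ) * (q + 2) = ((q + 1 + m).choose m : ℚ) * ((q : ℚ) + m + 2) := by
    have h := Nat.choose_mul_succ_eq (q + 1 + m) m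
    rw [show q + 1 + m + 1 - m = q + 2 by omega] at h
    have h' : (((q + 1 + m + 1).choose m * (q + 2) : ℕ) : ℚ) = (((q + 1 + m).choose m * (q + 1 + m + 1) : ℕ) : ℚ) := by
      rw [h]
    push_cast at h'
    linear_combination h'
  have hC : (0 : ℚ) < (q + 1 + m).choose m := by exact_mod_cast Nat.choose_pos (by omega)
  have hC' : (0 : ℚ) < (q + 1 + m + 1).choose m := by exact_mod_cast Nat.choose_pos (by omega)
  rw [div_eq_div_iff (by positivity) (by positivity)]
  linear_combination (-(2 * ((q : ℚ) + 1) * ∑ i ∈ range (m + 1), ((m : ℚ) + 1 - i) ^ 2 * ((q + 1 + m).choose i : ℚ))) * hCC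

end PercRepro
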